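import Literature.Computability.Complexity.HiraharaMachineEvalEq
import Literature.Computability.Complexity.HiraharaMachineEvalFP
import HarnessLib

/-!
# The machine of Hirahara's reduction, VII: the complete reduction is polynomial time on codes

Topic `Computability/Complexity`. Assembly of parts I–VI: the list-level reduction `redOutT c`
(the cascade of the degenerate-case tests of part I, the brute force, and the main output of
part IV) is computed on codes (`codeFP_redOutT`) and agrees with the specification
`HiraharaRed.redOut c` (`HiraharaSpec.lean`) on instance tuples (`redOutT_toTuple`, `c ≥ 1`);
through the identity of the instance code and the tuple code (`Pre.encode_eq`) this gives
**`redOut_codeFP`**: for every `c ≥ 1`, `(I₀, r) ↦ redOut c I₀ r` is a polynomial-time function of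
the code `⟨code(I₀), r⟩` — the implementation consumed by
`HiraharaRed.Hirahara2022_gapCMMSA_randReducible_MCSPStar_of_pairFn` (`MCSPStarFromRedOut.lean`).

## References

* S. Hirahara, *NP-hardness of learning programs and partial MCSP*, ECCC TR22-119, Lemma 8.3
  ("a randomized polynomial-time reduction") and proof of Thm. 8.5 [Hirahara2022PartialMCSP].
* S. Arora, B. Barak, *Computational Complexity: A Modern Approach*, CUP 2009, §1.2–1.3.
-/

namespace Literature.Computability.Complexity

open _root_.Computability
open Literature.Computability.MetaComplexity (MonotoneDNF sqrtLog CMMSAInstance)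
open CSPToCMMSAMachine (TO toE)
open CodeFP

namespace HiraharaMachine

/-! ### The complete reduction on tuples -/

/-- **The reduction on tuples**: the cascade of `HiraharaRed.redOut` with the list-level tests and
main output. [cite: Hirahara2022PartialMCSP, proof of Thm. 8.5 (MCSP* case)] -/
def redOutT (c : ℕ) (p : TO × List Bool) : List Bool :=
  if d1 p.1 then HiraharaRed.NO₀
  else if d2 p.1 then HiraharaRed.NO₀
  else if d7 p.1 then HiraharaRed.NO₀
  else if d3 p.1 then HiraharaRed.YES₀
  else if d4 p.1 then HiraharaRed.YES₀
  else if d5 p.1 then HiraharaRed.NO₀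
  else if d6 c p.1 then (if bruteT c p.1 then HiraharaRed.YES₀ else HiraharaRed.NO₀)
  else mainOutT p.1 p.2

/-- **The reduction on tuples is computed on codes.** [cite: Hirahara2022PartialMCSP, Lemma 8.3 and proof of Thm. 8.5] -/
theorem codeFP_redOutT (c : ℕ) : CodeFP inE strE (redOutT c) := by
  have hY : CodeFP inE strE (fun _ => HiraharaRed.YES₀) := const inE HiraharaRed.YES₀
  have hN : CodeFP inE strE (fun _ => HiraharaRed.NO₀) := const inE HiraharaRed.NO₀
  have e1 : CodeFP inE bitE (fun p => d1 p.1) := codeFP_d1.comp (fst _ _)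
  have e2 : CodeFP inE bitE (fun p => d2 p.1) := codeFP_d2.comp (fst _ _)
  have e7 : CodeFP inE bitE (fun p => d7 p.1) := codeFP_d7.comp (fst _ _)
  have e3 : CodeFP inE bitE (fun p => d3 p.1) := codeFP_d3.comp (fst _ _)
  have e4 : CodeFP inE bitE (fun p => d4 p.1) := codeFP_d4.comp (fst _ _)
  have e5 : CodeFP inE bitE (fun p => d5 p.1) := codeFP_d5.comp (fst _ _)
  have e6 : CodeFP inE bitE (fun p => d6 c p.1) := (codeFP_d6 c).comp (fst _ _)
  have eb : CodeFP inE bitE (fun p => bruteT c p.1) := (codeFP_bruteT c).comp (fst _ _)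
  have em : CodeFP inE strE (fun p => mainOutT p.1 p.2) := codeFP_mainOutT
  have h := e1.ite hN (e2.ite hN (e7.ite hN (e3.ite hY (e4.ite hY (e5.ite hN (e6.ite (eb.ite hY hN) em))))))
  exact h.congr fun p => by unfold redOutT; rfl

/-! ### Agreement with the specification -/

/-- The empty-formula test. [folklore] -/
theorem d2_toTuple (I₀ : CMMSAInstance) : d2 I₀.toTuple = true ↔ [] ∈ I₀.formulas := by
  unfold d2
  simp only [CMMSAInstance.toTuple, List.any_eq_true, List.isEmpty_iff]
  exact ⟨fun ⟨x, hx, h⟩ => h ▸ hx, fun h => ⟨[], h, rfl⟩⟩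

/-- The total-weight test. [folklore] -/
theorem d3_toTuple (I₀ : CMMSAInstance) (hwf : I₀.weight.length = I₀.numVars) :
    d3 I₀.toTuple = decide (HiraharaRed.Pre.totalW I₀ ≤ I₀.threshold) := by
  unfold d3; rw [HiraharaRed.Pre.totalW_eq_sum hwf]; rfl

/-- The kept-formula test. [folklore] -/
theorem d4_toTuple (I₀ : CMMSAInstance) : d4 I₀.toTuple = decide (HiraharaRed.Pre.kept I₀ = []) := by
  unfold d4; rw [keptT_toTuple, Bool.eq_iff_iff, List.isEmpty_iff, decide_eq_true_iff]

/-- The zero-threshold test. [folklore] -/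
theorem d5_toTuple (I₀ : CMMSAInstance) : d5 I₀.toTuple = decide (I₀.threshold = 0) := rfl

/-- The smallness test. [folklore] -/
theorem d6_toTuple (c : ℕ) (I₀ : CMMSAInstance) (hwf : I₀.weight.length = I₀.numVars) :
    d6 c I₀.toTuple = decide (sqrtLog I₀.numVars < c) := by
  unfold d6; rw [ΔT_eq _ hwf]; rfl

/-- **The reduction on tuples is the specified reduction** (for `c ≥ 1`). [cite: Hirahara2022PartialMCSP, proof of Thm. 8.5] -/
theorem redOutT_toTuple {c : ℕ} (hc : 1 ≤ c) (I₀ : CMMSAInstance) (r : List Bool) :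
    redOutT c (I₀.toTuple, r) = HiraharaRed.redOut c I₀ r := by
  classical
  unfold redOutT HiraharaRed.redOut
  simp only
  by_cases hwf' : I₀.WellFormed
  · have hwf : I₀.weight.length = I₀.numVars := hwf'.1
    have h1 : d1 I₀.toTuple = false := by
      unfold d1; rw [Bool.not_eq_false']; exact (wfT_toTuple I₀).2 hwf'
    rw [h1, if_neg (not_not.2 hwf')]
    simp only [Bool.false_eq_true, ↓reduceIte]
    by_cases hnil : [] ∈ I₀.formulas
    · rw [if_pos ((d2_toTuple I₀).2 hnil), if_pos hnil]
    rw [if_neg (fun h => hnil ((d2_toTuple I₀).1 h)), if_neg hnil, d7_toTuple I₀ hwf]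
    by_cases hdeg : sqrtLog I₀.numVars < I₀.degree
    · rw [decide_eq_true hdeg, if_pos rfl, if_pos hdeg]
    rw [decide_eq_false hdeg, if_neg hdeg, d3_toTuple I₀ hwf]
    simp only [Bool.false_eq_true, ↓reduceIte]
    by_cases hW : HiraharaRed.Pre.totalW I₀ ≤ I₀.threshold
    · rw [decide_eq_true hW, if_pos rfl, if_pos hW]
    rw [decide_eq_false hW, if_neg hW, d4_toTuple I₀]
    simp only [Bool.false_eq_true, ↓reduceIte]
    by_cases hk : HiraharaRed.Pre.kept I₀ = []
    · rw [decide_eq_true hk, if_pos rfl, if_pos hk]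
    rw [decide_eq_false hk, if_neg hk, d5_toTuple I₀]
    simp only [Bool.false_eq_true, ↓reduceIte]
    by_cases hθ : I₀.threshold = 0
    · rw [decide_eq_true hθ, if_pos rfl, if_pos hθ]
    rw [decide_eq_false hθ, if_neg hθ, d6_toTuple c I₀ hwf]
    simp only [Bool.false_eq_true, ↓reduceIte]
    by_cases hsmall : sqrtLog I₀.numVars < c
    · rw [decide_eq_true hsmall, if_pos rfl, if_pos hsmall, bruteT_toTuple c I₀ hwf hsmall]
    rw [decide_eq_false hsmall, if_neg hsmall]
    simp only [Bool.false_eq_true, ↓reduceIte]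
    -- the main branch: `Big` holds
    have h2 : 2 ≤ I₀.numVars := by
      have h1 : 1 ≤ sqrtLog I₀.numVars := le_trans hc (not_lt.1 hsmall)
      by_contra hlt
      have : sqrtLog I₀.numVars = 0 := by
        unfold MetaComplexity.sqrtLog
        interval_cases I₀.numVars <;> simp
      omega
    have hB := HiraharaRed.Pre.toPInst_big h2 hwf' (not_lt.1 hdeg) hnil (not_le.1 hW)
    exact mainOutT_toTuple I₀ hwf r hB
  · have h1 : d1 I₀.toTuple = true := by
      unfold d1; rw [Bool.not_eq_true']
      cases h : wfT I₀.toTuple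
      · rfl
      · exact absurd ((wfT_toTuple I₀).1 h) hwf'
    rw [h1, if_pos rfl, if_pos hwf']

/-! ### The reduction on instance codes -/

/-- **The complete reduction is computed in polynomial time on the code of the instance paired with
the coin string** (for every threshold constant `c ≥ 1`). [cite: Hirahara2022PartialMCSP, Lemma 8.3 ("a randomized polynomial-time reduction R") and proof of Thm. 8.5] -/
theorem redOut_codeFP (c : ℕ) (hc : 1 ≤ c) :
    CodeFP (pairE CMMSAInstance.encoding.encode (id : List Bool → List Bool)) (id : List Bool → List Bool)
      fun p : CMMSAInstance × List Bool => HiraharaRed.redOut c p.1 p.2 := by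
  have htr : CodeFP (pairE CMMSAInstance.encoding.encode strE) inE (fun p : CMMSAInstance × List Bool => (p.1.toTuple, p.2)) :=
    transparent fun p => by
      show boolPair (toE p.1.toTuple) (strE p.2) = boolPair (CMMSAInstance.encoding.encode p.1) (strE p.2)
      rw [HiraharaRed.Pre.encode_eq]
  have h : CodeFP (pairE CMMSAInstance.encoding.encode strE) strE (fun p : CMMSAInstance × List Bool => redOutT c (p.1.toTuple, p.2)) :=
    (codeFP_redOutT c).comp htr
  exact h.congr fun p => redOutT_toTuple hc p.1 p.2

end HiraharaMachine

end Literature.Computability.Complexity
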